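/-
Copyright (c) 2026 the pub-hodgecm-mathlib formalisation cell (harness21).  Prover seat hodgecm-mathlib-F0P3a-p01 (g39), explicit-unit SUPPORTS-ONLY on h413, req620 Track A
«(D-RAM) FOUR-FRAME» squad ((β₂) road (R-36), lane A (Unr-K): the RamK-TYPE DATUM OF THE INVOLUTION `Θ∘ρ` ON TYPE U — `Fix (Θ∘ρ)` has no element of odd order — so that
lane B's third-field ∕ chart producers apply in lane A to `Θ∘ρ`; sequel of `…UnrKNoThetaFixedChart`), 2026-09-05.
-/
import Summits.HodgeConjecture.HodgeConjecture.Theorems.F0P3cDyRamUnrKNoThetaFixedChart   -- (this seat): `v_theta_rho_sub_self_lt_one` (Θ∘ρ residually trivial on type U); brings ★ p864540, ★ `…TypeUBottomFacts`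
import Summits.HodgeConjecture.HodgeConjecture.Theorems.F0P3cDyRamRamKFrameClassLetters    -- ★ p864373 (LH4-p19 (g3)): `exists_refPair_of_frame` (the RamK reference pair — applied here to `Θ∘ρ`)
import Literature.NumberTheory.LocalFields.ValuedPrincipalUnitsProP                     -- ★ Lit: `lt_one_iff_le_exp_neg_one` (`γ < 1 ↔ γ ≤ exp(−1)` in `ℤᵐ⁰`)
import HarnessLib

/-!
# Crux `H413`, line LH4 «(D-RAM) FOUR-FRAME» — (β₂) road, lane A (type U ∕ Unr-K): «THE INVOLUTION `Θ∘ρ` IS A RAMIFIED QUADRATIC DATUM ON TYPE U» —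
# `IsRamifiedQuadraticDatum (Θ.comp ρ) (jE ϖ) d tE` from ‹OFF-A.letter.v2›'s letters

Cell `hodgecm-mathlib` (D-0151), FLOOR 0, crux item H413 = `stmt-HodgeConjecture-24833`, route of record `HCCMUnconditional`; squad F0∕P3c∕LH4; lane
`--supports stmt-HodgeConjecture-24833 --as helper` (count-neutral; pays NO tier-0 row).  THEOREMS ONLY (no `def`, no instance, no notation, no `sorry`, default heartbeats);
★-only imports; states NO census law; (β₂) stays a HYPOTHESIS.

WHY (this seat's `…UnrKNoThetaFixedChart` ROUTING note; LANE-A BOARD v4 §1).  On type U the third field `Fix Θ = K♮` is RAMIFIED over `F` (★ `exists_thirdFieldPackage_unr`) and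
carries no integral chart point (★ `not_exists_theta_fixed_integral_chart`), so the lane-B per-cell road cannot be instantiated on `Θ`.  The OTHER third field `Fix (Θ∘ρ)` is
the UNRAMIFIED one, and the pair `(ρ, Θ∘ρ)` satisfies lane B's RamK frame letters VERBATIM from the type-U block: `Θ∘ρ` is an isometric involution commuting with `ρ` and
restricting to `σ` on `jE(E)`; `|α − (Θ∘ρ)α| = |ρα − Θα| < 1` is `_hτ`; `_hσres` is unchanged; `|jEϖ − (Θ∘ρ)(jEϖ)| = |jEϖ|^d` is `_hddE`; `|2| = |jEϖ|^{tE}` is `_h2M`.  The one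
RamK letter that is NOT a type-U letter is the datum `IsRamifiedQuadraticDatum (Θ∘ρ) (jEϖ) d tE`, precisely its EVEN-ORDER clause «every non-zero `(Θ∘ρ)`-fixed element has
valuation `exp(2n)`» (= `M ∕ Fix(Θ∘ρ)` is ramified).  THIS FILE proves it, for ANY isometric involution `τ` of a complete-free (!) `ℤᵐ⁰`-valued field `M` with FINITE residue
field of characteristic `2` (`|2| < 1`) that is RESIDUALLY TRIVIAL (`|z| ≤ 1 ⇒ |τz − z| < 1`) and moves some integer `P` by exactly `|τP − P| = exp(−d)`:
* §1 `exists_fixed_near_of_residuallyTrivial` — RESIDUE SURJECTIVITY of `Fix τ`: every integer `z` is within `< 1` of a `τ`-fixed integer (`f := w·τw` with `w̄² = z̄`; squaring is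
  onto the finite residue field of characteristic `2`);
* §2 `exists_descent_of_fixed_uniformizer` — if some `τ`-fixed `y` has `|y| = exp(−1)`, then every integer is `s + yⁿ·r` with `τs = s`, `|r| ≤ 1` (induction on §1);
* §3 `false_of_fixed_uniformizer` — hence `|τP − P| = |y|^d·|τr − r| < exp(−d)`, contradicting `|τP − P| = exp(−d)`: NO `τ`-fixed element of valuation `exp(−1)`;
* §4 `exists_v_eq_exp_two_mul_of_fixed` — scaling by the `τ`-fixed `N := P·τP` (`|N| = exp(−2)`): every non-zero `τ`-fixed element has valuation `exp(2n)`;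
* §5 HEAD `isRamifiedQuadraticDatum_theta_comp_rho_of_letters` — at `τ := Θ.comp ρ` with ★ `v_theta_rho_sub_self_lt_one` and `P := jE ϖ`: the seven clauses of
  `IsRamifiedQuadraticDatum (Θ.comp ρ) (jE ϖ) d tE` from the type-U letters `_hD _h2 jE _hρρ _hvρ _hρj _hΘj _hΘΘ _hΘρ _hvΘ _hα _hα1 _hint _hτ _hσres _hjiso _hddE _h2M` BY NAME.
* §6 HEAD₂ `exists_thetaRho_refPair_of_letters` — THE LANE-A CHART: ★ p864373 `exists_refPair_of_frame` AT `Θ.comp ρ` (§5 supplies its `hDM`; its `hΘj hΘρ hσres hτ` are the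
  type-U letters rewritten): for every `n`, `κ₀ ξ₀` with `κ₀ + ρκ₀ = 1`, `Θκ₀ = 1 − κ₀`, `ρξ₀ = −ξ₀`, `Θξ₀ = −ξ₀`, `ξ₀ ≠ 0`, `|κ₀| ≤ 1`, `|ξ₀| = exp(2n)` (needs `_hjfix _hU _hq`).
CONSEQUENCE (routing, not a theorem): with §5, ★ `exists_thirdFieldPackage_ramK` ∕ ★ p864373 `exists_refPair_of_frame` ∕ ★ `forall_fixed_fixed_exists_mul_theta_eq_of_frame` apply
in lane A to the involution `Θ.comp ρ` (their remaining letters `hρρ hvρ hΘρ hα1 hU hq hσres hτ` are type-U letters), giving lane A reference pairs `(κ₀, ξ₀) ⊂ Fix(Θ∘ρ)`: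
`κ₀ + ρκ₀ = 1`, `|κ₀| ≤ 1`, `ρξ₀ = −ξ₀`, `|ξ₀| = exp(2n)` with `Θκ₀ = ρκ₀ = 1 − κ₀`, `Θξ₀ = ρξ₀ = −ξ₀` — the lane-A chart shape for the K6 desk.
HONEST LABEL.  Count-neutral local algebra; nothing printed is asserted; no census law is stated; the lane-A letters and (β₂) `stub_law_cleanSgn₂` stay HYPOTHESES ∕ UNPROVED;
`HC_CM` is proved only modulo the 7 printed citations (2 remaining named inputs: hLiu418 = `stmt-HodgeConjecture-24832`, h413 = `stmt-HodgeConjecture-24833`) until rung 0 closes.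
## References
* [Serre1979] J.-P. Serre, *Local Fields*, GTM 67 (1979): Ch. I §6–§7 (ramification of quadratic extensions of complete fields), Ch. III §3 Prop. 7, Ch. V §3 Cor. 3.
* [Rogawski1990] J. D. Rogawski, *Automorphic Representations of Unitary Groups in Three Variables*, Ann. of Math. Stud. 123 (1990): §4.9 Lemma 4.9.3 p. 56.
* [Kottwitz1986BaseChangeUnits] R. E. Kottwitz, *Base change for unit elements of Hecke algebras*, Compositio Math. 60 (1986): §1 pp. 240–241.
-/

set_option autoImplicit false

noncomputable section

namespace Summit.HodgeConjecture.HodgeConjecture.Cruxes.H413.F0P3cDyRamThetaRhoDatumOfTypeU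

open scoped Valued WithZero
open WithZero
open Literature.NumberTheory.Automorphic.UnitaryThreeFourFrame (IsRamifiedQuadraticDatum)
open Literature.NumberTheory.LocalFields (lt_one_iff_le_exp_neg_one)
open Summit.HodgeConjecture.HodgeConjecture.Cruxes.H413.F0P3cDyRamUnrKNoThetaFixedChart (v_theta_rho_sub_self_lt_one)
open Summit.HodgeConjecture.HodgeConjecture.Cruxes.H413.F0P3cDyRamRamKFrameClassLetters (exists_refPair_of_frame)

variable {M : Type} [Field M] [Valued M ℤᵐ⁰] {τ : M →+* M}

/-! ## §1 Residue surjectivity of the fixed field of a residually trivial involution (residue characteristic 2) -/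

/-- **RESIDUE SURJECTIVITY OF `Fix τ`**: `τ` an isometric involution with `|z| ≤ 1 ⇒ |τz − z| < 1`, finite residue field, `|2| < 1` ⇒ every integer `z` is within `< 1` of a
`τ`-fixed integer `f` (namely `f = w·τw` where `w̄² = z̄`: squaring is injective, hence onto, on the finite residue field of characteristic `2`).
[cite: Serre1979, Ch. I §7] -/
theorem exists_fixed_near_of_residuallyTrivial [Finite 𝓀[M]] (hττ : ∀ x, τ (τ x) = x) (hvτ : ∀ x, Valued.v (τ x) = Valued.v x)
    (hres : ∀ z : M, Valued.v z ≤ 1 → Valued.v (τ z - z) < 1) (h2 : Valued.v (2 : M) < 1)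
    {z : M} (hz : Valued.v z ≤ 1) : ∃ f : M, τ f = f ∧ Valued.v f ≤ 1 ∧ Valued.v (z - f) < 1 := by
  classical
  -- `2 = 0` in the residue field, so squaring is injective, hence surjective
  have h2k : (2 : 𝓀[M]) = 0 := by
    rw [← map_ofNat (IsLocalRing.residue 𝒪[M]) 2, IsLocalRing.residue_eq_zero_iff, IsLocalRing.mem_maximalIdeal, mem_nonunits_iff,
      Valuation.Integer.not_isUnit_iff_valuation_lt_one]
    exact_mod_cast h2
  have hsq : Function.Surjective (fun a : 𝓀[M] => a * a) := by
    refine Finite.injective_iff_surjective.1 (fun a b hab => ?_)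
    have hab' : a * a = b * b := hab
    have h0 : (a - b) * (a - b) = 0 := by
      have e : (a - b) * (a - b) = a * a + b * b - 2 * (a * b) := by ring
      rw [e, h2k, zero_mul, sub_zero, hab', ← two_mul, h2k, zero_mul]
    exact sub_eq_zero.1 (mul_self_eq_zero.1 h0)
  -- lift a square root of `z̄`
  let zO : 𝒪[M] := ⟨z, (Valuation.mem_integer_iff _ _).2 hz⟩
  obtain ⟨wbar, hw⟩ := hsq (IsLocalRing.residue 𝒪[M] zO)
  obtain ⟨w, rfl⟩ := IsLocalRing.residue_surjective wbar
  have hw1 : Valued.v (w : M) ≤ 1 := (Valuation.mem_integer_iff _ _).1 w.2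
  have hτw1 : Valued.v (τ w) ≤ 1 := by rw [hvτ]; exact hw1
  let τwO : 𝒪[M] := ⟨τ w, (Valuation.mem_integer_iff _ _).2 hτw1⟩
  refine ⟨(w : M) * τ w, ?_, ?_, ?_⟩
  · rw [map_mul, hττ, mul_comm]
  · rw [Valuation.map_mul]; exact mul_le_one' hw1 hτw1
  · -- residues: `res(τw) = res(w)` (residual triviality), so `res(z − w·τw) = z̄ − w̄² = 0`
    have hresw : IsLocalRing.residue 𝒪[M] τwO = IsLocalRing.residue 𝒪[M] w := by
      rw [← sub_eq_zero, ← map_sub, IsLocalRing.residue_eq_zero_iff, IsLocalRing.mem_maximalIdeal, mem_nonunits_iff,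
        Valuation.Integer.not_isUnit_iff_valuation_lt_one]
      exact hres w hw1
    have hdiff : IsLocalRing.residue 𝒪[M] (zO - w * τwO) = 0 := by
      have hw' : IsLocalRing.residue 𝒪[M] w * IsLocalRing.residue 𝒪[M] w = IsLocalRing.residue 𝒪[M] zO := hw
      rw [map_sub, map_mul, hresw, hw', sub_self]
    rw [IsLocalRing.residue_eq_zero_iff, IsLocalRing.mem_maximalIdeal, mem_nonunits_iff, Valuation.Integer.not_isUnit_iff_valuation_lt_one] at hdiff
    exact hdiff

/-! ## §2 Descent along a `τ`-fixed uniformiser -/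

/-- **DESCENT**: under §1's letters, a `τ`-fixed `y` with `|y| = exp(−1)` writes every integer as `z = s + yⁿ·r` with `τs = s` and `|r| ≤ 1`, for every `n`.
[cite: Serre1979, Ch. I §6] -/
theorem exists_descent_of_fixed_uniformizer [Finite 𝓀[M]] (hττ : ∀ x, τ (τ x) = x) (hvτ : ∀ x, Valued.v (τ x) = Valued.v x)
    (hres : ∀ z : M, Valued.v z ≤ 1 → Valued.v (τ z - z) < 1) (h2 : Valued.v (2 : M) < 1)
    {y : M} (hy : Valued.v y = exp (-1 : ℤ)) (hτy : τ y = y) :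
    ∀ (n : ℕ) (z : M), Valued.v z ≤ 1 → ∃ s r : M, τ s = s ∧ Valued.v r ≤ 1 ∧ z = s + y ^ n * r := by
  have hy0 : y ≠ 0 := fun h0 => by rw [h0, map_zero] at hy; exact (exp_ne_zero hy.symm).elim
  intro n
  induction n with
  | zero => exact fun z hz => ⟨0, z, map_zero τ, hz, by rw [pow_zero, one_mul, zero_add]⟩
  | succ n ih =>
    intro z hz
    obtain ⟨s, r, hτs, hr1, hz'⟩ := ih z hz
    obtain ⟨f, hτf, hf1, hrf⟩ := exists_fixed_near_of_residuallyTrivial hττ hvτ hres h2 hr1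
    -- `|r − f| < 1 ⇒ |r − f| ≤ |y|`, so `r' := (r − f)∕y` is an integer
    have hle : Valued.v (r - f) ≤ Valued.v y := by rw [hy]; exact (lt_one_iff_le_exp_neg_one _).1 hrf
    refine ⟨s + y ^ n * f, (r - f) / y, ?_, ?_, ?_⟩
    · rw [map_add, map_mul, map_pow, hτs, hτy, hτf]
    · rw [Valuation.map_div]
      exact div_le_one_of_le₀ hle zero_le
    · rw [hz', pow_succ]
      field_simp
      ring

/-! ## §3 No `τ`-fixed uniformiser -/

/-- **NO `τ`-FIXED ELEMENT OF VALUATION `exp(−1)`** when `τ` moves some integer `P` by exactly `|τP − P| = exp(−d)`: by §2 at `z := P`, `n := d` one gets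
`τP − P = y^d·(τr − r)`, so `|τP − P| < exp(−d)` by residual triviality at `r`. [cite: Serre1979, Ch. I §6–§7] -/
theorem false_of_fixed_uniformizer [Finite 𝓀[M]] (hττ : ∀ x, τ (τ x) = x) (hvτ : ∀ x, Valued.v (τ x) = Valued.v x)
    (hres : ∀ z : M, Valued.v z ≤ 1 → Valued.v (τ z - z) < 1) (h2 : Valued.v (2 : M) < 1)
    {P : M} (hP1 : Valued.v P ≤ 1) {d : ℕ} (hτP : Valued.v (τ P - P) = exp (-(d : ℤ)))
    {y : M} (hy : Valued.v y = exp (-1 : ℤ)) (hτy : τ y = y) : False := by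
  obtain ⟨s, r, hτs, hr1, hP⟩ := exists_descent_of_fixed_uniformizer hττ hvτ hres h2 hy hτy d P hP1
  have e : τ P - P = y ^ d * (τ r - r) := by
    rw [hP, map_add, map_mul, map_pow, hτs, hτy]; ring
  have hlt : Valued.v (τ P - P) < exp (-(d : ℤ)) := by
    rw [e, Valuation.map_mul, Valuation.map_pow, hy, ← exp_nsmul, nsmul_eq_mul, mul_neg, mul_one]
    calc exp (-(d : ℤ)) * Valued.v (τ r - r) < exp (-(d : ℤ)) * 1 := mul_lt_mul_of_pos_left (hres r hr1) (exp_pos)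
      _ = exp (-(d : ℤ)) := mul_one _
  exact absurd hτP (ne_of_lt hlt)

/-! ## §4 Even orders on `Fix τ` -/

/-- **EVERY NON-ZERO `τ`-FIXED ELEMENT HAS EVEN ORDER**: under §3's letters, `τx = x`, `x ≠ 0` ⇒ `|x| = exp(2n)` (an odd order, rescaled by the `τ`-fixed `N := P·τP` of
valuation `exp(−2)` — `|τP| = |P| = exp(−1)` — would give a `τ`-fixed element of valuation `exp(−1)`). [cite: Serre1979, Ch. I §7] [cite: Rogawski1990, §4.9 Lemma 4.9.3 p. 56] -/
theorem exists_v_eq_exp_two_mul_of_fixed [Finite 𝓀[M]] (hττ : ∀ x, τ (τ x) = x) (hvτ : ∀ x, Valued.v (τ x) = Valued.v x)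
    (hres : ∀ z : M, Valued.v z ≤ 1 → Valued.v (τ z - z) < 1) (h2 : Valued.v (2 : M) < 1)
    {P : M} (hP : Valued.v P = exp (-1 : ℤ)) {d : ℕ} (hτP : Valued.v (τ P - P) = exp (-(d : ℤ)))
    {x : M} (hτx : τ x = x) (hx0 : x ≠ 0) : ∃ n : ℤ, Valued.v x = exp (2 * n) := by
  have hP1 : Valued.v P ≤ 1 := by rw [hP, ← exp_zero, exp_le_exp]; norm_num
  have hP0 : P ≠ 0 := fun h0 => by rw [h0, map_zero] at hP; exact (exp_ne_zero hP.symm).elim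
  -- the order `k` of `x`
  have hvx0 : Valued.v x ≠ 0 := (Valuation.ne_zero_iff _).2 hx0
  obtain ⟨k, hk⟩ : ∃ k : ℤ, Valued.v x = exp k := ⟨_, (exp_log hvx0).symm⟩
  rcases Int.even_or_odd k with ⟨n, hn⟩ | ⟨n, hn⟩
  · exact ⟨n, by rw [hk, hn, two_mul]⟩
  · -- odd order: rescale to a `τ`-fixed element of valuation `exp(−1)`
    exfalso
    set N : M := P * τ P with hN
    have hτN : τ N = N := by rw [hN, map_mul, hττ, mul_comm]
    have hvN : Valued.v N = exp (-2 : ℤ) := by rw [hN, Valuation.map_mul, hvτ, hP, ← exp_add]; norm_num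
    have hN0 : N ≠ 0 := fun h0 => by rw [h0, map_zero] at hvN; exact (exp_ne_zero hvN.symm).elim
    set y : M := x * N ^ (n + 1) with hydef
    have hτy : τ y = y := by rw [hydef, map_mul, map_zpow₀, hτx, hτN]
    have hy : Valued.v y = exp (-1 : ℤ) := by
      rw [hydef, Valuation.map_mul, map_zpow₀, hk, hvN, ← exp_zsmul, ← exp_add, hn]
      congr 1
      rw [smul_eq_mul]; ring
    exact false_of_fixed_uniformizer hττ hvτ hres h2 hP1 hτP hy hτy

/-! ## §5 HEAD — the datum of `Θ∘ρ` on type U -/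

variable {ρ Θ : M →+* M} {α : M}

/-- **HEAD — `IsRamifiedQuadraticDatum (Θ.comp ρ) (jE ϖ) d tE` ON TYPE U, FROM ‹OFF-A.letter.v2›'s LETTERS BY NAME.**  The seven clauses: involution (`Θρ = ρΘ`, both
involutions); isometry; `|jEϖ| = exp(−1)` (`_hjiso`, `_hD`); EVEN ORDER on `Fix(Θ∘ρ)` (§4 at `τ := Θ.comp ρ`, residual triviality ★ `v_theta_rho_sub_self_lt_one`, `P := jEϖ`,
`|ΘρP − P| = |P|^d` from `_hddE`); `|jEϖ − Θρ(jEϖ)| = |jEϖ|^d` (`_hρj`, `_hddE`); `1 ≤ d` (`_hD`); `|2| = |jEϖ|^{tE}` (`_h2M`).  With it, lane B's RamK producers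
(★ `exists_thirdFieldPackage_ramK`, ★ `exists_refPair_of_frame`, …) instantiate in lane A at the involution `Θ.comp ρ`.
[cite: Serre1979, Ch. I §7; Ch. V §3 Cor. 3] [cite: Rogawski1990, §4.9 Lemma 4.9.3 p. 56] [cite: Kottwitz1986BaseChangeUnits, §1 pp. 240–241] -/
theorem isRamifiedQuadraticDatum_theta_comp_rho_of_letters [Finite 𝓀[M]]
    {E : Type} [Field E] [Valued E ℤᵐ⁰] {σ : E →+* E} {ϖ : E} {d tE : ℕ} (hD : IsRamifiedQuadraticDatum σ ϖ d tE) (h2E : ¬ IsUnit (2 : 𝒪[E]))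
    (jE : E →+* M) (hρρ : ∀ x, ρ (ρ x) = x) (hvρ : ∀ x, Valued.v (ρ x) = Valued.v x) (hρj : ∀ a, ρ (jE a) = jE a)
    (hΘΘ : ∀ x, Θ (Θ x) = x) (hΘρ : ∀ x, Θ (ρ x) = ρ (Θ x)) (hvΘ : ∀ x, Valued.v (Θ x) = Valued.v x)
    (hα : ρ α ≠ α) (hα1 : Valued.v α ≤ 1) (hint : ∀ z : M, Valued.v z ≤ 1 → Valued.v ((z - ρ z) / (α - ρ α)) ≤ 1)
    (hτ : Valued.v (ρ α - Θ α) < 1) (hσres : ∀ z : M, ρ z = z → Valued.v z ≤ 1 → Valued.v (Θ z - z) < 1)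
    (hjiso : ∀ a, Valued.v (jE a) = Valued.v a) (hddE : Valued.v (jE ϖ - Θ (jE ϖ)) = Valued.v (jE ϖ) ^ d)
    (h2M : Valued.v (2 : M) = Valued.v (jE ϖ) ^ tE) :
    IsRamifiedQuadraticDatum (Θ.comp ρ) (jE ϖ) d tE := by
  obtain ⟨-, -, hϖ, -, -, hd1, -⟩ := id hD
  have hjϖ : Valued.v (jE ϖ) = exp (-1 : ℤ) := by rw [hjiso, hϖ]
  have h2v : Valued.v (2 : E) < 1 := by exact_mod_cast Valuation.Integer.not_isUnit_iff_valuation_lt_one.mp h2E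
  have h2 : Valued.v (2 : M) < 1 := by rw [← map_ofNat jE 2, hjiso]; exact h2v
  -- the letters of the involution `τ := Θ ∘ ρ`
  have hττ : ∀ x, (Θ.comp ρ) ((Θ.comp ρ) x) = x := fun x => by
    simp only [RingHom.comp_apply]
    rw [← hΘρ, hρρ, hΘΘ]
  have hvτ : ∀ x, Valued.v ((Θ.comp ρ) x) = Valued.v x := fun x => by rw [RingHom.comp_apply, hvΘ, hvρ]
  have hres : ∀ z : M, Valued.v z ≤ 1 → Valued.v ((Θ.comp ρ) z - z) < 1 := fun z hz =>
    v_theta_rho_sub_self_lt_one hρρ hvρ hΘΘ hvΘ hα hα1 hint hτ hσres hz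
  have hτP : Valued.v ((Θ.comp ρ) (jE ϖ) - jE ϖ) = exp (-(d : ℤ)) := by
    rw [RingHom.comp_apply, hρj, ← Valuation.map_neg, neg_sub, hddE, hjϖ, ← exp_nsmul, nsmul_eq_mul, mul_neg, mul_one]
  refine ⟨hττ, hvτ, hjϖ, fun x hx hx0 => ?_, ?_, hd1, h2M⟩
  · exact exists_v_eq_exp_two_mul_of_fixed hττ hvτ hres h2 hjϖ hτP hx hx0
  · rw [RingHom.comp_apply, hρj, hddE]

/-! ## §6 HEAD₂ — the lane-A chart: a reference pair in `Fix (Θ∘ρ)` -/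

/-- **HEAD₂ — THE LANE-A (Unr-K) REFERENCE PAIR**: ★ p864373 `exists_refPair_of_frame` applied to the involution `Θ.comp ρ` (whose RamK letters are type-U letters, `hDM` from
§5): for every `n : ℕ` there are `κ₀ ξ₀ : M` with `κ₀ + ρκ₀ = 1`, `Θκ₀ = 1 − κ₀`, `ρξ₀ = −ξ₀`, `Θξ₀ = −ξ₀`, `ξ₀ ≠ 0`, `|κ₀| ≤ 1`, `|ξ₀| = exp(2n)` — the chart of the line
`Tr_ρ = 1` INSIDE `Fix(Θ∘ρ)` (on which `Θ` acts as `ρ`), i.e. the lane-A replacement for the unsatisfiable Θ-fixed chart letters `(hκ₀ hΘκ₀ hκ₀1)` of the lane-B per-cell files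
(★ `…UnrKNoThetaFixedChart`).  Letters: ‹OFF-A.letter.v2›'s `_hD _h2 jE _hρρ _hvρ _hρj _hjfix _hΘj _hΘΘ _hΘρ _hvΘ _hα _hα1 _hint _hU _hτ _hσres _hjiso _hq _hddE _h2M` BY NAME.
[cite: Serre1979, Ch. V §2 Prop. 3; Ch. III §6 Prop. 12] [cite: Rogawski1990, §4.9 Lemma 4.9.3 p. 56] [cite: Kottwitz1986BaseChangeUnits, §1 pp. 240–241] -/
theorem exists_thetaRho_refPair_of_letters [CompleteSpace M] [Finite 𝓀[M]]
    {E : Type} [Field E] [Valued E ℤᵐ⁰] {σ : E →+* E} {ϖ : E} {d tE : ℕ} (hD : IsRamifiedQuadraticDatum σ ϖ d tE) (h2E : ¬ IsUnit (2 : 𝒪[E]))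
    (jE : E →+* M) (hρρ : ∀ x, ρ (ρ x) = x) (hvρ : ∀ x, Valued.v (ρ x) = Valued.v x) (hρj : ∀ a, ρ (jE a) = jE a)
    (hjfix : ∀ z : M, ρ z = z ↔ ∃ a, jE a = z) (hΘj : ∀ a, Θ (jE a) = jE (σ a))
    (hΘΘ : ∀ x, Θ (Θ x) = x) (hΘρ : ∀ x, Θ (ρ x) = ρ (Θ x)) (hvΘ : ∀ x, Valued.v (Θ x) = Valued.v x)
    (hα : ρ α ≠ α) (hα1 : Valued.v α ≤ 1) (hint : ∀ z : M, Valued.v z ≤ 1 → Valued.v ((z - ρ z) / (α - ρ α)) ≤ 1)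
    (hU : Valued.v (α - ρ α) = 1) (hτ : Valued.v (ρ α - Θ α) < 1) (hσres : ∀ z : M, ρ z = z → Valued.v z ≤ 1 → Valued.v (Θ z - z) < 1)
    (hjiso : ∀ a, Valued.v (jE a) = Valued.v a) (hq : Nat.card 𝓀[M] = Nat.card 𝓀[E] ^ 2) (hddE : Valued.v (jE ϖ - Θ (jE ϖ)) = Valued.v (jE ϖ) ^ d)
    (h2M : Valued.v (2 : M) = Valued.v (jE ϖ) ^ tE) (n : ℕ) :
    ∃ κ₀ ξ₀ : M, κ₀ + ρ κ₀ = 1 ∧ Θ κ₀ = 1 - κ₀ ∧ ρ ξ₀ = -ξ₀ ∧ Θ ξ₀ = -ξ₀ ∧ ξ₀ ≠ 0 ∧ Valued.v κ₀ ≤ 1 ∧ Valued.v ξ₀ = exp (2 * (n : ℤ)) := by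
  have hDM := isRamifiedQuadraticDatum_theta_comp_rho_of_letters hD h2E jE hρρ hvρ hρj hΘΘ hΘρ hvΘ hα hα1 hint hτ hσres hjiso hddE h2M
  -- the RamK letters of `Θ ∘ ρ`, rewritten from the type-U letters
  have hΘj' : ∀ c, (Θ.comp ρ) (jE c) = jE (σ c) := fun c => by rw [RingHom.comp_apply, hρj, hΘj]
  have hΘρ' : ∀ x, (Θ.comp ρ) (ρ x) = ρ ((Θ.comp ρ) x) := fun x => by
    simp only [RingHom.comp_apply]
    rw [hρρ, ← hΘρ, hρρ]
  have hσres' : ∀ z : M, ρ z = z → Valued.v z ≤ 1 → Valued.v ((Θ.comp ρ) z - z) < 1 := fun z hz hz1 => by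
    rw [RingHom.comp_apply, hz]; exact hσres z hz hz1
  have hτ' : Valued.v (α - (Θ.comp ρ) α) < 1 := by
    rw [RingHom.comp_apply, ← Valuation.map_neg, neg_sub, show Θ (ρ α) - α = Θ (ρ α - Θ α) by rw [map_sub, hΘΘ], hvΘ]
    exact hτ
  obtain ⟨κ₀, ξ₀, hκ, hΘκ, hρξ, hΘξ, hξ0, hκ1, hξv⟩ :=
    exists_refPair_of_frame hD jE hjiso hjfix hΘj' hρρ hvρ hΘρ' hα1 hU hDM hq hσres' hτ' n
  -- `Θ` acts as `ρ` on `Fix (Θ∘ρ)`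
  have hΘκ' : Θ κ₀ = ρ κ₀ := by
    have e : Θ κ₀ = Θ (ρ (ρ κ₀)) := by rw [hρρ]
    rw [e, hΘρ]
    exact congrArg ρ hΘκ
  have hΘξ' : Θ ξ₀ = ρ ξ₀ := by
    have e : Θ ξ₀ = Θ (ρ (ρ ξ₀)) := by rw [hρρ]
    rw [e, hΘρ]
    exact congrArg ρ hΘξ
  refine ⟨κ₀, ξ₀, hκ, ?_, hρξ, ?_, hξ0, hκ1, hξv⟩
  · rw [hΘκ']; linear_combination hκ
  · rw [hΘξ', hρξ]

end Summit.HodgeConjecture.HodgeConjecture.Cruxes.H413.F0P3cDyRamThetaRhoDatumOfTypeU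

end
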